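import Summits.QuantumFields.BalabanUV.T4Continuum.Support.TorusSmallFieldGlobalGaugeSharpPrep
import Summits.QuantumFields.BalabanUV.T4Continuum.Support.MinimalActionRate
import Literature.Analysis.Matrix.DetExp
import HarnessLib

/-!
# TorusSmallFieldGlobalGaugeSharp — THE SECTOR HYPOTHESIS OF `torusSmallFieldGlobalGauge` CANNOT BE DROPPED (the global `exp A` gauge of gen 26 is SHARP IN SHAPE):
# the unit-flux abelian configuration on the `M`-torus (part 1, `…SharpPrep`) has all plaquettes within `2π∕M²` of `1` (`card n·M²·η = 2π·card n`, `M`-independent)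
# and admits NO `M`-periodic gauge in which every bond is `exp A_b` with `‖A_b‖ ≤ 1∕(4·card n)`; hence no pair of constants `(c₀, C)` with `c₀ ≥ 2π·card n` makes
# the global-gauge letter true, and the letter with the sector hypothesis deleted is FALSE for every gauge constant `C`

Cell `pub-balaban`, rung (B)+1 sub-cell t4, lineage `b2b-balaban-t4-ne7b-p1` (row NE7b OWNER + CRUX PROVER), generation 156; junction census for the road's fork (S-i)
(`t4/b2b-balaban-t4-ne7-p1-g108/ROAD-G108.md` §4bis NEXT (i): «`hsector` … lifting it = handling nontrivial flat sectors … or restrict dom to the trivial sector and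
sharpen `TorusSmallFieldGlobalGauge`»).  THIS FILE answers the second alternative in the negative AT THE LEVEL OF THE LETTER: the displayed hypothesis
`hsector : card n·N²·ε ≤ sectorConst n` of the docked END `NE7Route1EndDockedSmallDataSU2Reg` (✓ p803830) is the sector hypothesis of gen 26's
`TorusSmallFieldGlobalGauge.torusSmallFieldGlobalGauge` read at level `k` (`M = N·L^k`, `η = ε∕L^{2k}`, `M²η = N²ε`), and that hypothesis is NECESSARY IN SHAPE for
the letter's conclusion: only its constant is negotiable (the admissible sector constants lie in `[sectorConst n, 2π·card n)`).
THE OBSTRUCTION ([folklore]; determinant ∕ trace ∕ discrete Stokes).  If `u` is `M`-periodic and `u(x)U(x,κ)u(x+e_κ)⁻¹ = exp A(x,κ)` with `‖A(x,κ)‖ ≤ 1∕(4·card n)`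
at all bonds, put `t(x,κ) = tr A(x,κ)` (`|t| ≤ card n·‖A‖ ≤ 1∕4`); `det exp A = e^{tr A}` (tree `Literature.Analysis.Matrix.det_exp_eq_exp_trace`) and `det D(z) = z`
give `e^{t(x,0) + t(x+e₀,1) − t(x+e₁,0) − t(x,1)} = e^{2πi∕M²}` (the `det u` factors cancel around the plaquette), so the exponent IS `2πi∕M²` (the two sides of the
congruence are `< 2π` apart, `M ≥ 2`); `t` is `M`-periodic (periodic exponentials, `|t| ≤ 1∕4`); summing over the `M²` plaquettes of one `(0,1)`-slice the left side
telescopes to `0` while the right side is `2πi` — contradiction.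
WHAT ([folklore]; 0 def, 0 sorry).  §4 `norm_trace_le_card_mul`, `eq_of_cexp_eq_of_norm_sub_lt`, `det_coe_units_inv`, `slice_shifts`, **`no_small_log_gauge`** (the
obstruction, for ANY periodic `u`, unitary or not); §5 **`exists_smallField_no_global_log_gauge`** (the witness, instantiating part 1's equational hypotheses),
**`sector_threshold_lt`** (any admissible `(c₀, C)` has `c₀ < 2π·card n`), **`not_globalGauge_without_sector`** (gen 26's conclusion with `hsec` deleted is false for
every `C`), `sectorConst_lt_two_pi_card` (both theorems bite: the threshold lies in `[sectorConst n, 2π·card n)`); §6 docking to the END's class: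
**`exists_mem_sfClass_no_global_log_gauge`** — at `ε = 2π∕N²` (i.e. `card n·N²·ε = 2π·card n`) the small-field class `sfClass 4 L N ε k` of EVERY level `k` with
`N·L^k ≥ 2` contains a member with no `N·L^k`-periodic small-logarithm gauge (the class is `U(n)`-valued: `IsUnitaryCfg`).
HONEST FRAMING (page 1): an explicit lattice configuration and elementary matrix algebra; a NEGATIVE statement about OUR letter (gen 26) — it says nothing about
gauges that are not of the global small-logarithm form `exp A`, `‖A‖ ≤ 1∕(4·card n)`, and nothing about `SU(n)`-valued classes (the witness has `det ≠ 1`; for `SU(2)` the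
analogous obstruction is topological charge and is NOT typed here); `hsector` itself is a HYPOTHESIS of the END, untouched by this file; nothing of Bałaban's asserted;
NE3∕NE7 NOT proved; row NE7b (`T4WeightBudget.RelWeightBound`) NOT PRINTED ∕ NOT PROVED; spine count = dagwriter's call; finite T⁴ rung (B)+1 — NOT infinite volume,
NOT mass gap, NOT BetaPertH, NOT Clay (continuum YM on T⁴ ⇐ BetaPertH ∧ nine spine estimates).
-/

set_option autoImplicit false

open scoped BigOperators Matrix Matrix.Norms.L2Operator
open Finset NormedSpace Complex

namespace Summit.QuantumFields.BalabanUV.T4Continuum.TorusSmallFieldGlobalGaugeSharp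

open Literature.MathematicalPhysics.QuantumFieldTheory.Balaban1983to89
open B7Prop1Explicit B7Prop2Explicit
open T4AveragingDeficitWall hiding Site Plane Plaq Bond
open T4AveragingDeficitWallBoundary (IsPeriodicCfg)
open NE3EnergyShapes (IsUnitarySite IsPeriodicSite)
open TorusSmallFieldGlobalGauge (sectorConst gaugeConst isPeriodicCfg_gaugeAct torusSmallFieldGlobalGauge_explicit)
open TorusSmallFieldGlobalGaugeSharpPrep
open MinimalActionRate (sfClass)

noncomputable section

variable {n : Type*} [Fintype n] [DecidableEq n]

/-! ## §4 The obstruction: no `M`-periodic gauge puts the unit-flux configuration in the form `exp A` with `‖A‖ ≤ 1∕(4·card n)` -/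

section Obstruction

/-- `‖tr X‖ ≤ card n·‖X‖` (operator norm; via the tree's normalised-trace letter `‖ntr X‖ ≤ ‖X‖`). [folklore] -/
theorem norm_trace_le_card_mul [Nonempty n] (X : Matrix n n ℂ) : ‖X.trace‖ ≤ (Fintype.card n : ℝ) * ‖X‖ := by
  have hc : (0 : ℝ) < Fintype.card n := by exact_mod_cast Fintype.card_pos
  have hc' : (Fintype.card n : ℂ) ≠ 0 := by exact_mod_cast hc.ne'
  have h := MatrixNorms.norm_ntr_le_opNorm X
  have hntr : X.trace = (Fintype.card n : ℂ) * MatrixNorms.ntr X := by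
    show X.trace = (Fintype.card n : ℂ) * (X.trace / (Fintype.card n : ℂ))
    field_simp
  rw [hntr, norm_mul, Complex.norm_natCast]
  exact mul_le_mul_of_nonneg_left h hc.le

/-- Two complex numbers with the same exponential and less than `2π` apart are equal. [folklore] -/
theorem eq_of_cexp_eq_of_norm_sub_lt {a b : ℂ} (h : cexp a = cexp b) (hab : ‖a - b‖ < 2 * Real.pi) : a = b := by
  obtain ⟨k, hk⟩ := Complex.exp_eq_exp_iff_exists_int.mp h
  have hk' : a - b = k * (2 * Real.pi * I) := by rw [hk]; ring
  by_contra hne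
  have hk0 : k ≠ 0 := by
    rintro rfl
    apply hne
    simpa using hk
  have h1 : (1 : ℝ) ≤ |(k : ℝ)| := by exact_mod_cast Int.one_le_abs hk0
  have hnorm : ‖a - b‖ = |(k : ℝ)| * (2 * Real.pi) := by
    rw [hk', norm_mul, Complex.norm_intCast]
    congr 1
    rw [norm_mul, Complex.norm_I, mul_one, Complex.norm_mul, Complex.norm_real, Real.norm_eq_abs,
      abs_of_pos Real.pi_pos]
    norm_num
  have : 2 * Real.pi ≤ ‖a - b‖ := by
    rw [hnorm]
    nlinarith [Real.pi_pos]
  linarith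

/-- The determinant of an inverse unit. [folklore] -/
theorem det_coe_units_inv (w : (Matrix n n ℂ)ˣ) :
    (((w⁻¹ : (Matrix n n ℂ)ˣ)) : Matrix n n ℂ).det = ((((w : (Matrix n n ℂ)ˣ)) : Matrix n n ℂ).det)⁻¹ := by
  have h : (((w⁻¹ : (Matrix n n ℂ)ˣ)) : Matrix n n ℂ).det * ((((w : (Matrix n n ℂ)ˣ)) : Matrix n n ℂ).det) = 1 := by
    rw [← Matrix.det_mul, ← Units.val_mul, inv_mul_cancel, Units.val_one, Matrix.det_one]
  exact eq_inv_of_mul_eq_one_left h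

/-- The sites `(a, b, 0, 0)` of the `(0,1)`-slice and their shifts. [folklore] -/
theorem slice_shifts (a b c : ℤ) :
    ((![a, b, 0, 0] : Site 4) + e 0 = ![a + 1, b, 0, 0]) ∧ ((![a, b, 0, 0] : Site 4) + e 1 = ![a, b + 1, 0, 0]) ∧
    ((![a, b, 0, 0] : Site 4) + c • e 0 = ![a + c, b, 0, 0]) ∧ ((![a, b, 0, 0] : Site 4) + c • e 1 = ![a, b + c, 0, 0]) := by
  refine ⟨?_, ?_, ?_, ?_⟩ <;> funext i <;> fin_cases i <;> simp [e_apply]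

variable {M : ℕ} {θ : Site 4 → Fin 4 → ℝ}
  (hθ0 : ∀ x : Site 4, θ x 0 = if x 0 % (M : ℤ) = (M : ℤ) - 1 then -(2 * Real.pi * ((x 1 : ℤ) : ℝ) / (M : ℝ)) else 0)
  (hθ1 : ∀ x : Site 4, θ x 1 = 2 * Real.pi * (((x 0 % (M : ℤ) : ℤ)) : ℝ) / (M : ℝ) ^ 2)
  {i₀ : n} {U : Site 4 → Fin 4 → (Matrix n n ℂ)ˣ}
  (hU : ∀ x μ, ((U x μ : (Matrix n n ℂ)ˣ) : Matrix n n ℂ) = Matrix.diagonal (Function.update (1 : n → ℂ) i₀ (cexp (I * θ x μ))))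
include hθ0 hθ1 hU

/-- **THE OBSTRUCTION.**  For `M ≥ 2`, an `M`-periodic diagonal phase configuration with the unit-flux phases admits NO `M`-periodic site field `u` (unitary or not)
and NO logarithm field `A` with `u(x)U(x,κ)u(x+e_κ)⁻¹ = exp A(x,κ)` and `‖A(x,κ)‖ ≤ 1∕(4·card n)` at every bond: taking determinants, `tr A` would be an `M`-periodic
field whose `(0,1)`-plaquette sums are all exactly `2πi∕M²`, and summing them over one `M × M` slice gives `0 = 2πi`. [folklore] -/
theorem no_small_log_gauge [Nonempty n] (hM : 2 ≤ M) (hP : IsPeriodicCfg U (M : ℤ))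
    {u : Site 4 → (Matrix n n ℂ)ˣ} (hu : IsPeriodicSite u (M : ℤ)) {A : Site 4 → Fin 4 → Matrix n n ℂ}
    (hA : ∀ (x : Site 4) (κ : Fin 4), ((gaugeAct u U x κ : (Matrix n n ℂ)ˣ) : Matrix n n ℂ) = exp (A x κ))
    (hδ : ∀ (x : Site 4) (κ : Fin 4), ‖A x κ‖ ≤ 1 / (4 * (Fintype.card n : ℝ))) : False := by
  have hM1 : 1 ≤ M := Nat.le_trans (by norm_num) hM
  have hMr : (0 : ℝ) < (M : ℝ) := by exact_mod_cast hM1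
  have hcard : (0 : ℝ) < Fintype.card n := by exact_mod_cast Fintype.card_pos
  have hπ := Real.pi_gt_three
  -- (1) the traces are small
  have htb : ∀ (x : Site 4) (κ : Fin 4), ‖(A x κ).trace‖ ≤ 1 / 4 := by
    intro x κ
    refine (norm_trace_le_card_mul (A x κ)).trans ?_
    calc (Fintype.card n : ℝ) * ‖A x κ‖ ≤ Fintype.card n * (1 / (4 * (Fintype.card n : ℝ))) := mul_le_mul_of_nonneg_left (hδ x κ) hcard.le
      _ = 1 / 4 := by field_simp
  -- (2) determinants: `e^{tr A(x,κ)} = det u(x) · e^{iθ(x,κ)} · (det u(x+e_κ))⁻¹`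
  have hdetexp : ∀ (x : Site 4) (κ : Fin 4), (exp (A x κ)).det = cexp ((A x κ).trace) := by
    intro x κ
    rw [Literature.Analysis.Matrix.det_exp_eq_exp_trace, ← Complex.exp_eq_exp_ℂ]
  have hdet : ∀ (x : Site 4) (κ : Fin 4), cexp ((A x κ).trace)
      = ((u x : (Matrix n n ℂ)ˣ) : Matrix n n ℂ).det * cexp (I * θ x κ) * ((((u (x + e κ) : (Matrix n n ℂ)ˣ)) : Matrix n n ℂ).det)⁻¹ := by
    intro x κ
    rw [← hdetexp, ← hA x κ]
    simp only [gaugeAct, Units.val_mul, Matrix.det_mul, det_coe_units_inv, det_bond_of_phaseCfg hU]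
  have hune : ∀ x : Site 4, ((u x : (Matrix n n ℂ)ˣ) : Matrix n n ℂ).det ≠ 0 := fun x =>
    ((Matrix.isUnit_iff_isUnit_det _).mp (u x).isUnit).ne_zero
  -- (3) the `(0,1)` plaquette sums of `tr A` are exactly `2πi∕M²`
  have hS : ∀ x : Site 4, (A x 0).trace + (A (x + e 0) 1).trace - (A (x + e 1) 0).trace - (A x 1).trace
      = I * ((2 * Real.pi / (M : ℝ) ^ 2 : ℝ) : ℂ) := by
    intro x
    have hexp : cexp ((A x 0).trace + (A (x + e 0) 1).trace - (A (x + e 1) 0).trace - (A x 1).trace)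
        = cexp (I * ((2 * Real.pi / (M : ℝ) ^ 2 : ℝ) : ℂ)) := by
      rw [← plaqPhase_zero_one hθ0 hθ1 hM1 x]
      have hrhs : I * ((θ x 0 + θ (x + e 0) 1 - θ (x + e 1) 0 - θ x 1 : ℝ) : ℂ)
          = I * θ x 0 + I * θ (x + e 0) 1 - I * θ (x + e 1) 0 - I * θ x 1 := by push_cast; ring
      rw [hrhs, Complex.exp_sub, Complex.exp_sub, Complex.exp_add, Complex.exp_sub, Complex.exp_sub, Complex.exp_add,
        hdet, hdet, hdet, hdet, show x + e 0 + e 1 = x + e 1 + e 0 from add_right_comm _ _ _]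
      have h1 := hune x
      have h2 := hune (x + e 0)
      have h3 := hune (x + e 1)
      have h4 := hune (x + e 1 + e 0)
      have e1 := Complex.exp_ne_zero (I * θ x 0)
      have e2 := Complex.exp_ne_zero (I * θ (x + e 0) 1)
      have e3 := Complex.exp_ne_zero (I * θ (x + e 1) 0)
      have e4 := Complex.exp_ne_zero (I * θ x 1)
      field_simp
    refine eq_of_cexp_eq_of_norm_sub_lt hexp ?_
    have hc : ‖I * ((2 * Real.pi / (M : ℝ) ^ 2 : ℝ) : ℂ)‖ ≤ Real.pi / 2 := by
      rw [norm_mul, Complex.norm_I, one_mul, Complex.norm_real, Real.norm_eq_abs, abs_of_nonneg (by positivity)]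
      have hM2 : (4 : ℝ) ≤ (M : ℝ) ^ 2 := by
        have : (2 : ℝ) ≤ M := by exact_mod_cast hM
        nlinarith
      rw [div_le_div_iff₀ (by positivity) (by norm_num)]
      nlinarith [Real.pi_pos]
    calc ‖(A x 0).trace + (A (x + e 0) 1).trace - (A (x + e 1) 0).trace - (A x 1).trace - I * ((2 * Real.pi / (M : ℝ) ^ 2 : ℝ) : ℂ)‖
        ≤ ‖(A x 0).trace‖ + ‖(A (x + e 0) 1).trace‖ + ‖(A (x + e 1) 0).trace‖ + ‖(A x 1).trace‖ + ‖I * ((2 * Real.pi / (M : ℝ) ^ 2 : ℝ) : ℂ)‖ := by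
          refine (norm_sub_le _ _).trans ?_
          gcongr
          refine (norm_sub_le _ _).trans ?_
          gcongr
          refine (norm_sub_le _ _).trans ?_
          gcongr
          exact norm_add_le _ _
      _ ≤ 1 / 4 + 1 / 4 + 1 / 4 + 1 / 4 + Real.pi / 2 := by gcongr <;> apply htb
      _ < 2 * Real.pi := by linarith
  -- (4) `tr A` is `M`-periodic
  have hper : ∀ (x : Site 4) (j κ : Fin 4), (A (x + (M : ℤ) • e j) κ).trace = (A x κ).trace := by
    intro x j κ
    have hV := isPeriodicCfg_gaugeAct hu hP x j κ
    have h1 : cexp ((A (x + (M : ℤ) • e j) κ).trace) = cexp ((A x κ).trace) := by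
      rw [← hdetexp, ← hdetexp, ← hA, ← hA, hV]
    refine eq_of_cexp_eq_of_norm_sub_lt h1 ?_
    calc ‖(A (x + (M : ℤ) • e j) κ).trace - (A x κ).trace‖ ≤ ‖(A (x + (M : ℤ) • e j) κ).trace‖ + ‖(A x κ).trace‖ := norm_sub_le _ _
      _ ≤ 1 / 4 + 1 / 4 := add_le_add (htb _ _) (htb _ _)
      _ < 2 * Real.pi := by linarith
  -- (5) discrete Stokes on the `M × M` slice `{(a, b, 0, 0)}`: the plaquette sums telescope to `0` …
  set f : ℕ → ℕ → ℂ := fun a b => (A (![(a : ℤ), (b : ℤ), 0, 0]) 0).trace with hf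
  set g : ℕ → ℕ → ℂ := fun a b => (A (![(a : ℤ), (b : ℤ), 0, 0]) 1).trace with hg
  have hSab : ∀ a b : ℕ, (f a b - f a (b + 1)) + (g (a + 1) b - g a b) = I * ((2 * Real.pi / (M : ℝ) ^ 2 : ℝ) : ℂ) := by
    intro a b
    rw [← hS ![(a : ℤ), (b : ℤ), 0, 0], (slice_shifts (a : ℤ) (b : ℤ) 0).1, (slice_shifts (a : ℤ) (b : ℤ) 0).2.1]
    simp only [hf, hg]
    push_cast
    ring
  have hfper : ∀ a : ℕ, f a M = f a 0 := by
    intro a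
    simp only [hf]
    rw [← hper ![(a : ℤ), ((0 : ℕ) : ℤ), 0, 0] 1 0, (slice_shifts (a : ℤ) ((0 : ℕ) : ℤ) (M : ℤ)).2.2.2]
    push_cast
    rw [zero_add]
  have hgper : ∀ b : ℕ, g M b = g 0 b := by
    intro b
    simp only [hg]
    rw [← hper ![((0 : ℕ) : ℤ), (b : ℤ), 0, 0] 0 1, (slice_shifts ((0 : ℕ) : ℤ) (b : ℤ) (M : ℤ)).2.2.1]
    push_cast
    rw [zero_add]
  have hsum0 : ∑ a ∈ Finset.range M, ∑ b ∈ Finset.range M, ((f a b - f a (b + 1)) + (g (a + 1) b - g a b)) = 0 := by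
    simp only [Finset.sum_add_distrib]
    rw [Finset.sum_comm (f := fun a b => g (a + 1) b - g a b)]
    have h1 : ∀ a ∈ Finset.range M, ∑ b ∈ Finset.range M, (f a b - f a (b + 1)) = 0 := by
      intro a _
      rw [Finset.sum_range_sub', hfper, sub_self]
    have h2 : ∀ b ∈ Finset.range M, ∑ a ∈ Finset.range M, (g (a + 1) b - g a b) = 0 := by
      intro b _
      rw [Finset.sum_range_sub (fun a => g a b) M, hgper, sub_self]
    rw [Finset.sum_eq_zero h1, Finset.sum_eq_zero h2, add_zero]
  -- … while each of the `M²` terms is `2πi∕M²`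
  have hsum1 : ∑ a ∈ Finset.range M, ∑ b ∈ Finset.range M, ((f a b - f a (b + 1)) + (g (a + 1) b - g a b))
      = (M : ℂ) * ((M : ℂ) * (I * ((2 * Real.pi / (M : ℝ) ^ 2 : ℝ) : ℂ))) := by
    simp only [hSab, Finset.sum_const, Finset.card_range, nsmul_eq_mul]
  rw [hsum1] at hsum0
  have hM0 : (M : ℂ) ≠ 0 := by exact_mod_cast (Nat.lt_of_lt_of_le Nat.zero_lt_one hM1).ne'
  have hc0 : ((2 * Real.pi / (M : ℝ) ^ 2 : ℝ) : ℂ) ≠ 0 := by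
    have : (0 : ℝ) < 2 * Real.pi / (M : ℝ) ^ 2 := by positivity
    exact_mod_cast this.ne'
  exact (mul_ne_zero hM0 (mul_ne_zero hM0 (mul_ne_zero Complex.I_ne_zero hc0))) hsum0

end Obstruction

/-! ## §5 The sharpness statements -/

section Sharp

variable [Nonempty n]

/-- **THE WITNESS.**  For every period `M ≥ 2` there is a `U(n)`-valued, `M`-periodic configuration on `ℤ⁴` with ALL PLAQUETTE VARIABLES WITHIN `2π∕M²` OF `1` (so
`card n·M²·η = 2π·card n`, independent of `M`) such that for every `M`-periodic site field `u` and every logarithm field `A` with `u(x)U(x,κ)u(x+e_κ)⁻¹ = exp A(x,κ)`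
at all bonds, SOME bond has `‖A(x,κ)‖ > 1∕(4·card n)` — the unit-flux configuration of §3. [folklore] -/
theorem exists_smallField_no_global_log_gauge {M : ℕ} (hM : 2 ≤ M) :
    ∃ U : Site 4 → Fin 4 → (Matrix n n ℂ)ˣ, IsUnitaryCfg U ∧ IsPeriodicCfg U (M : ℤ) ∧ SmallField U (2 * Real.pi / (M : ℝ) ^ 2) ∧
      ∀ u : Site 4 → (Matrix n n ℂ)ˣ, IsPeriodicSite u (M : ℤ) → ∀ A : Site 4 → Fin 4 → Matrix n n ℂ,
        (∀ (x : Site 4) (κ : Fin 4), ((gaugeAct u U x κ : (Matrix n n ℂ)ˣ) : Matrix n n ℂ) = exp (A x κ)) →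
          ∃ (x : Site 4) (κ : Fin 4), 1 / (4 * (Fintype.card n : ℝ)) < ‖A x κ‖ := by
  obtain ⟨i₀⟩ := ‹Nonempty n›
  have hM1 : 1 ≤ M := Nat.le_trans (by norm_num) hM
  -- the unit-flux phases
  let θ : Site 4 → Fin 4 → ℝ := fun x μ =>
    if μ = 0 then (if x 0 % (M : ℤ) = (M : ℤ) - 1 then -(2 * Real.pi * ((x 1 : ℤ) : ℝ) / (M : ℝ)) else 0)
    else if μ = 1 then 2 * Real.pi * (((x 0 % (M : ℤ) : ℤ)) : ℝ) / (M : ℝ) ^ 2 else 0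
  have hθ0 : ∀ x : Site 4, θ x 0 = if x 0 % (M : ℤ) = (M : ℤ) - 1 then -(2 * Real.pi * ((x 1 : ℤ) : ℝ) / (M : ℝ)) else 0 :=
    fun x => by simp [θ]
  have hθ1 : ∀ x : Site 4, θ x 1 = 2 * Real.pi * (((x 0 % (M : ℤ) : ℤ)) : ℝ) / (M : ℝ) ^ 2 := fun x => by simp [θ]
  have hθ2 : ∀ x : Site 4, θ x 2 = 0 := fun x => by simp [θ]
  have hθ3 : ∀ x : Site 4, θ x 3 = 0 := fun x => by simp [θ]
  -- the configuration `U(x, μ) = D(e^{iθ(x,μ)})` as units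
  let U : Site 4 → Fin 4 → (Matrix n n ℂ)ˣ := fun x μ =>
    ⟨Matrix.diagonal (Function.update (1 : n → ℂ) i₀ (cexp (I * θ x μ))),
      Matrix.diagonal (Function.update (1 : n → ℂ) i₀ (cexp (I * θ x μ))⁻¹),
      by rw [phaseMat_mul, mul_inv_cancel₀ (Complex.exp_ne_zero _), phaseMat_one],
      by rw [phaseMat_mul, inv_mul_cancel₀ (Complex.exp_ne_zero _), phaseMat_one]⟩
  have hU : ∀ x μ, ((U x μ : (Matrix n n ℂ)ˣ) : Matrix n n ℂ) = Matrix.diagonal (Function.update (1 : n → ℂ) i₀ (cexp (I * θ x μ))) :=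
    fun _ _ => rfl
  refine ⟨U, isUnitaryCfg_of_phaseCfg hU, isPeriodicCfg_unitFlux hθ0 hθ1 hθ2 hθ3 hU hM1, smallField_unitFlux hθ0 hθ1 hθ2 hθ3 hU hM1, ?_⟩
  intro u hu A hA
  by_contra h
  push Not at h
  exact no_small_log_gauge hθ0 hθ1 hU hM (isPeriodicCfg_unitFlux hθ0 hθ1 hθ2 hθ3 hU hM1) hu hA h

/-- **ANY ADMISSIBLE SECTOR CONSTANT IS BELOW `2π·card n`, WHATEVER THE GAUGE CONSTANT.**  If the global-gauge letter (gen 26's shape: sector hypothesis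
`card n·M²·η ≤ c₀` ⟹ an `M`-periodic unitary gauge with every bond `exp A`, `‖A‖ ≤ C(M⁻¹ + Mη)`) holds with constants `(c₀, C)`, then `c₀ < 2π·card n`: otherwise
the unit-flux configuration (`η = 2π∕M²`) is admissible for every `M`, and `C(M⁻¹ + 2π∕M) ≤ 1∕(4·card n)` for `M` large contradicts §4. [folklore] -/
theorem sector_threshold_lt {c₀ C : ℝ}
    (h : ∀ M : ℕ, 1 ≤ M → ∀ η : ℝ, 0 ≤ η → (Fintype.card n : ℝ) * (M : ℝ) ^ 2 * η ≤ c₀ →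
      ∀ U : Site 4 → Fin 4 → (Matrix n n ℂ)ˣ, IsUnitaryCfg U → IsPeriodicCfg U (M : ℤ) → SmallField U η →
        ∃ u : Site 4 → (Matrix n n ℂ)ˣ, IsUnitarySite u ∧ IsPeriodicSite u (M : ℤ) ∧
          ∃ A : Site 4 → Fin 4 → Matrix n n ℂ, ∀ (x : Site 4) (κ : Fin 4),
            ((gaugeAct u U x κ : (Matrix n n ℂ)ˣ) : Matrix n n ℂ) = exp (A x κ) ∧ ‖A x κ‖ ≤ C * (((M : ℝ))⁻¹ + (M : ℝ) * η)) :
    c₀ < 2 * Real.pi * Fintype.card n := by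
  by_contra hc
  push Not at hc
  have hcard : (0 : ℝ) < Fintype.card n := by exact_mod_cast Fintype.card_pos
  -- a large period
  obtain ⟨M, hM2, hMC⟩ : ∃ M : ℕ, 2 ≤ M ∧ 4 * (Fintype.card n : ℝ) * |C| * (1 + 2 * Real.pi) < M := by
    refine ⟨⌈4 * (Fintype.card n : ℝ) * |C| * (1 + 2 * Real.pi)⌉₊ + 2, by omega, ?_⟩
    push_cast
    linarith [Nat.le_ceil (4 * (Fintype.card n : ℝ) * |C| * (1 + 2 * Real.pi))]
  have hM1 : 1 ≤ M := Nat.le_trans (by norm_num) hM2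
  have hMr : (0 : ℝ) < M := by exact_mod_cast hM1
  have hη0 : 0 ≤ 2 * Real.pi / (M : ℝ) ^ 2 := by positivity
  have hsec : (Fintype.card n : ℝ) * (M : ℝ) ^ 2 * (2 * Real.pi / (M : ℝ) ^ 2) ≤ c₀ := by
    have : (Fintype.card n : ℝ) * (M : ℝ) ^ 2 * (2 * Real.pi / (M : ℝ) ^ 2) = 2 * Real.pi * Fintype.card n := by
      field_simp
    rw [this]
    exact hc
  obtain ⟨U, hUu, hUp, hUs, hno⟩ := exists_smallField_no_global_log_gauge (n := n) hM2
  obtain ⟨u, -, hu, A, hA⟩ := h M hM1 _ hη0 hsec U hUu hUp hUs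
  obtain ⟨x, κ, hx⟩ := hno u hu A (fun x κ => (hA x κ).1)
  have hb := (hA x κ).2
  have hMη : ((M : ℝ))⁻¹ + (M : ℝ) * (2 * Real.pi / (M : ℝ) ^ 2) = (1 + 2 * Real.pi) / M := by
    field_simp
  rw [hMη] at hb
  have h1 : C * ((1 + 2 * Real.pi) / M) ≤ |C| * ((1 + 2 * Real.pi) / M) := mul_le_mul_of_nonneg_right (le_abs_self C) (by positivity)
  have h2 : |C| * ((1 + 2 * Real.pi) / M) < 1 / (4 * (Fintype.card n : ℝ)) := by
    rw [← mul_div_assoc, div_lt_div_iff₀ hMr (by positivity)]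
    nlinarith
  linarith

/-- **THE SECTOR HYPOTHESIS CANNOT BE DROPPED.**  The statement of gen 26's `TorusSmallFieldGlobalGauge.torusSmallFieldGlobalGauge` with the sector hypothesis
`card n·M²·η ≤ c₀` DELETED is false for every gauge constant `C`: there is no `C` such that every unitary `M`-periodic `U` with `SmallField U η` has an `M`-periodic
unitary gauge `u` and a logarithm field `A` with `u(x)U(x,κ)u(x+e_κ)⁻¹ = exp A(x,κ)`, `‖A(x,κ)‖ ≤ C(M⁻¹ + Mη)`.  (For the docked END ✓ p803830 this is the hypothesis
`hsector : card n·N²·ε ≤ sectorConst n`, read at level `k` with `M = N·L^k`, `η = ε∕L^{2k}`.) [folklore] -/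
theorem not_globalGauge_without_sector :
    ¬ ∃ C : ℝ, ∀ M : ℕ, 1 ≤ M → ∀ η : ℝ, 0 ≤ η →
      ∀ U : Site 4 → Fin 4 → (Matrix n n ℂ)ˣ, IsUnitaryCfg U → IsPeriodicCfg U (M : ℤ) → SmallField U η →
        ∃ u : Site 4 → (Matrix n n ℂ)ˣ, IsUnitarySite u ∧ IsPeriodicSite u (M : ℤ) ∧
          ∃ A : Site 4 → Fin 4 → Matrix n n ℂ, ∀ (x : Site 4) (κ : Fin 4),
            ((gaugeAct u U x κ : (Matrix n n ℂ)ˣ) : Matrix n n ℂ) = exp (A x κ) ∧ ‖A x κ‖ ≤ C * (((M : ℝ))⁻¹ + (M : ℝ) * η) := by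
  rintro ⟨C, hC⟩
  have h := sector_threshold_lt (n := n) (c₀ := 2 * Real.pi * Fintype.card n) (C := C)
    (fun M hM η hη _ U hUu hUp hUs => hC M hM η hη U hUu hUp hUs)
  exact lt_irrefl _ h

/-- **BOTH THEOREMS BITE**: gen 26's admissible pair `(sectorConst n, gaugeConst n)` and §4 together give `sectorConst n < 2π·card n` — the threshold of the
sector condition in the letter `card n·M²·η ≤ c` lies in `[sectorConst n, 2π·card n)`. [folklore] -/
theorem sectorConst_lt_two_pi_card : sectorConst n < 2 * Real.pi * Fintype.card n :=
  sector_threshold_lt (C := gaugeConst n) fun _ hM _ hη hsec _ hUu hUp hUs => torusSmallFieldGlobalGauge_explicit hM hη hsec hUu hUp hUs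

end Sharp

/-! ## §6 Docking to the END's class `sfClass 4 L N ε k` (`U(n)`-valued, `N·L^k`-periodic, plaquette radius `ε∕L^{2k}`) -/

section Dock

variable [Nonempty n]

/-- **IN THE END's LETTERS.**  At `ε = 2π∕N²` — i.e. `card n·N²·ε = 2π·card n`, a fixed multiple above the END's `hsector : card n·N²·ε ≤ sectorConst n` — the
small-field class `sfClass 4 L N ε k` of EVERY level `k` with `N·L^k ≥ 2` contains a configuration admitting NO `N·L^k`-periodic site field `u` and logarithm field
`A` with `u(x)U(x,κ)u(x+e_κ)⁻¹ = exp A(x,κ)`, `‖A(x,κ)‖ ≤ 1∕(4·card n)` at all bonds: node O's global `exp A` background coordinate around `U = 1` does not extend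
to the whole class beyond the sector condition, at any level. [folklore] -/
theorem exists_mem_sfClass_no_global_log_gauge {L N k : ℕ} (hM : 2 ≤ N * L ^ k) :
    ∃ U ∈ sfClass 4 L N (2 * Real.pi / (N : ℝ) ^ 2) k,
      ∀ u : Site 4 → (Matrix n n ℂ)ˣ, IsPeriodicSite u ((N * L ^ k : ℕ) : ℤ) → ∀ A : Site 4 → Fin 4 → Matrix n n ℂ,
        (∀ (x : Site 4) (κ : Fin 4), ((gaugeAct u U x κ : (Matrix n n ℂ)ˣ) : Matrix n n ℂ) = exp (A x κ)) →
          ∃ (x : Site 4) (κ : Fin 4), 1 / (4 * (Fintype.card n : ℝ)) < ‖A x κ‖ := by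
  obtain ⟨U, hUu, hUp, hUs, hno⟩ := exists_smallField_no_global_log_gauge (n := n) hM
  have hrad : 2 * Real.pi / (((N * L ^ k : ℕ) : ℝ)) ^ 2 = 2 * Real.pi / (N : ℝ) ^ 2 / ((L : ℝ) ^ k) ^ 2 := by
    push_cast
    rw [mul_pow, div_div]
  refine ⟨U, ⟨hUu, hUp, ?_⟩, hno⟩
  rw [← hrad]
  exact hUs

end Dock

end

end Summit.QuantumFields.BalabanUV.T4Continuum.TorusSmallFieldGlobalGaugeSharp
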